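import Summits.HodgeConjecture.HodgeConjecture.Theorems.Ring2BindersAbelianSchemeVHCCurveSection
import HarnessLib

/-!
# Ring 2 — binder seat b02 (Hodge ladder stage 3): the forms of row b02 `AbelianSchemeVHC` AS NAMED NODES, and the
# sharp fact-free form on one-parameter abelian schemes — ONE algebraic fibre forces UNCOUNTABLY MANY

HONEST FRAMING: research route conditional on HC_CM; not a corollary; Q11.4-sentence-2 already refuted in dim ≥ 3.

Cell `pub-hodge-ring2`, binder seat `ring2-b02`, row b02 of `BINDER-OWNERS.md` (`Ring2.Hypotheses.AbelianSchemeVHC`,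
`Theorems/Ring2Hypotheses.lean`:140; OPEN, print-equivalent to `HC_AV`, nothing to discharge). `HC_CM` is not mentioned
in any statement below; nothing here is a case of the Hodge conjecture; no `sorry`, no Literature named fact is
introduced; nothing is discharged and no number of `BINDER-OWNERS.md` moves. LEAD L43 (census v33): the with-section /
one-parameter equivalences of `Ring2BindersAbelianSchemeVHCSection.lean` (p235652) and
`Ring2BindersAbelianSchemeVHCCurveSection.lean` (p236292) are typed there against LOCAL NOTATIONS, hence opaque-inline
to the cell's edge census; this file gives the statements importable NAMES (`@[conjecture] def`, obligation nodes,
never asserted) and re-derives every edge BY NAME from the landed theorems — plus one new, sharper node.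

§1 NODES (symbol for symbol the bodies of the landed notations, except (U) which is new):
* `AbelianSchemeVHCSection` — row b02 on families WITH A SECTION `e ≫ f = 𝟙 S` over smooth irreducible AFFINE bases
  (abelian schemes in print: [cite: MumfordGIT, Thm. 6.14], [cite: LaurentSchroer2023, Prop. 4.3]);
* `OneParameterAbelianSchemeVHC` — the same over smooth irreducible affine CURVES (`topologicalKrullDim S = 1`);
* `OneParameterAbelianSchemeVHCGerm` — germ form on one-parameter abelian schemes with quasi-projective total space:
  one algebraic fibre forces a non-empty Euclidean-OPEN set of algebraic fibres;
* (U) `OneParameterAbelianSchemeVHCUncountable` — NEW and weaker: one algebraic fibre forces an UNCOUNTABLE set of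
  algebraic fibres;
* `AbelianSchemeQuasiProjective` ⟹ `OneParameterAbelianSchemeQuasiProjective` — the print residuals (total spaces
  of abelian-fibred families with a section over smooth irreducible affine bases / curves are quasi-projective over
  `ℂ`: [cite: GortzWedhorn2023, Thm. 27.291] after [cite: Raynaud1970, Ch. XI], with [cite: LaurentSchroer2023, Prop. 4.3];
  THEOREMS IN PRINT, unformalised — typed as obligation nodes exactly like `Ring2.Hypotheses.MumfordTateCMAnchors`).
§2 EDGES BY NAME (all fact-free unless displayed): `AbelianSchemeVHC ↔ AbelianSchemeVHCSection ↔
OneParameterAbelianSchemeVHC` (unconditional); `AbelianSchemeVHC → …Germ → …Uncountable`; and, modulo the curve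
residual only, `…Uncountable → AbelianSchemeVHC` — so **row b02 ⟺ (U)** (`abelianSchemeVHC_iff_uncountable_of_…`),
hence ⟺ the germ form; `VariationalHodgeQP → AbelianSchemeVHC` (part XXVII's printed-carrier node) modulo the same;
`HC_AV ↔ OneParameterAbelianSchemeVHC` modulo André 1996 #21/#22, and `HC_AV ↔ (U)` modulo #21/#22 + the residual.
§3 WHY (U) IS THE SHARP THRESHOLD of the closing method (Charles–Schnell Prop. 11.3.11, proof; tree theorems
`charlesSchnell_algebraicityLocus_iUnion_closed_holds`, `Theorems.mem_algebraicClasses_of_thickSet`,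
`Theorems.finite_of_isClosed_ne_univ_of_topologicalKrullDim_le_one`): over a smooth irreducible affine curve the
algebraicity locus of a global class is a countable union of complex-point sets of Zariski-closed subsets, each
FINITE or everything; so an uncountable locus is everything (`curve_not_subset_iUnion_of_not_countable`), while EVERY
countable set of complex points is covered by countably many proper closed subsets (`exists_subset_iUnion_of_countable`)
— countably many algebraic fibres (for instance all fibres over a countable dense set of the base, which is all
that the density of special points offers by itself) never trigger the closing lemma: a kernel-level counterpart, on
row b02's own carriers, of the cell's standing line "CM density alone is not a transport mechanism".

What is NOT claimed: any node; any case of `AbelianSchemeVHC`; anything about `HC_CM`; the residuals. The section-free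
residual `AbelianTotalQuasiProjective[]` of the junction file (p230163) is superseded since p235652 and not named.

References: [Grothendieck1966] fn. 13; [CharlesSchnell2014Notes] Conj. 11.3.1, Prop. 11.3.11 (proof);
[MumfordAV1970] §6 Lemma; [MumfordGIT] Thm. 6.14; [LaurentSchroer2023] Prop. 4.3, Thm. 5.3; [GortzWedhorn2023]
Thm. 27.291; [Raynaud1970] Ch. XI, XIII (locators second-hand, text not held: acq-09263); [Deligne1982HodgeCycles]
Milne 2003 re-edition endnote 19; [Andre1996Motifs] §6.3; [SerreGAGA1956] §2; [VoisinHodgeII2003] §7.3.2.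
-/

-- every declaration of this problem lives in `Summit.HodgeConjecture.HodgeConjecture.…` (summit = sub-problem);
-- namespace `…Ring2.Binders` = the binder seats of the cell's Hodge-ladder stage 3 (`BINDER-OWNERS.md`)
set_option linter.dupNamespace false

noncomputable section

open CategoryTheory AlgebraicGeometry Topology
open Literature.AlgebraicGeometry Literature.AlgebraicGeometry.Motives
open Literature.AlgebraicGeometry.HodgeTheory
open Literature.AlgebraicGeometry.Andre1996 (andre1996_cmAnchoredPencil
  andre1996_cmHodgeClasses_algebraicallyAnchoredPencils)

namespace Summit.HodgeConjecture.HodgeConjecture.Ring2.Binders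

open Summit.HodgeConjecture.HodgeConjecture.Ring2.Hypotheses

/-! ## §1 The nodes -/

/-- **`AbelianSchemeVHCSection` — row b02 on abelian schemes (families WITH A SECTION) over smooth irreducible AFFINE
bases**: for `f : 𝒳 ⟶ S` a smooth projective family of relative dimension `n` over a smooth irreducible affine `S`,
all complex fibres abelian varieties, with a section `e ≫ f = 𝟙 S`, and `W ∈ H²ᵖ(𝒳(ℂ);ℂ)` fibrewise rational `(p,p)`:
algebraic at one `s₀` ⟹ algebraic at every `s`. Symbol for symbol the notation `AbelianSchemeVHCSectionAffine[]` of
`Ring2BindersAbelianSchemeVHCSection.lean`; ⟺ row b02 (`abelianSchemeVHC_iff_abelianSchemeVHCSection`). OPEN; a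
HYPOTHESIS wherever used, never asserted. [cite: Grothendieck1966, footnote 13] [cite: CharlesSchnell2014Notes, Conj. 11.3.1]
[cite: MumfordGIT, Thm. 6.14] [cite: LaurentSchroer2023, Prop. 4.3] -/
@[conjecture] def AbelianSchemeVHCSection : Prop :=
  ∀ ⦃n : ℕ⦄ ⦃𝒳 S : SchemeOver ℂ⦄ (f : 𝒳 ⟶ S), IsSmoothProjectiveFamily f n → IrreducibleSpace S.left →
    IsAffine S.left → AlgebraicGeometry.Smooth S.hom →
    (∀ s : ComplexPoints S, ∃ A' : AbelianVariety ℂ, A'.dim = n ∧ Nonempty (A'.X ≅ fiberOver f s)) →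
    (∃ e : S ⟶ 𝒳, e ≫ f = 𝟙 S) →
    ∀ (p : ℕ) (W : complexBetti 𝒳 (2 * p)),
      (∀ s : ComplexPoints S, IsRationalClass (complexBetti.map (fiberι f s) (2 * p) W) ∧
        IsOfHodgeType n (fiberOver f s) (2 * p) p p (complexBetti.map (fiberι f s) (2 * p) W)) →
      (∃ s₀ : ComplexPoints S,
        complexBetti.map (fiberι f s₀) (2 * p) W ∈ algebraicClasses (fiberOver f s₀) p) →
      ∀ s : ComplexPoints S, complexBetti.map (fiberι f s) (2 * p) W ∈ algebraicClasses (fiberOver f s) p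

/-- **`OneParameterAbelianSchemeVHC` — row b02 on ONE-PARAMETER abelian schemes**: the same statement over smooth
irreducible affine CURVES (`topologicalKrullDim S.left = 1`). Symbol for symbol the notation
`AbelianSchemeVHCSectionCurve[]` of `Ring2BindersAbelianSchemeVHCCurveSection.lean`; ⟺ row b02
(`abelianSchemeVHC_iff_oneParameterAbelianSchemeVHC`, Mumford's curve lemma being a tree theorem). OPEN; a HYPOTHESIS
wherever used. [cite: Grothendieck1966, footnote 13] [cite: CharlesSchnell2014Notes, Conj. 11.3.1] [cite: MumfordAV1970, §6, Lemma] -/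
@[conjecture] def OneParameterAbelianSchemeVHC : Prop :=
  ∀ ⦃n : ℕ⦄ ⦃𝒳 S : SchemeOver ℂ⦄ (f : 𝒳 ⟶ S), IsSmoothProjectiveFamily f n → IrreducibleSpace S.left →
    IsAffine S.left → AlgebraicGeometry.Smooth S.hom → topologicalKrullDim S.left = 1 →
    (∀ s : ComplexPoints S, ∃ A' : AbelianVariety ℂ, A'.dim = n ∧ Nonempty (A'.X ≅ fiberOver f s)) →
    (∃ e : S ⟶ 𝒳, e ≫ f = 𝟙 S) →
    ∀ (p : ℕ) (W : complexBetti 𝒳 (2 * p)),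
      (∀ s : ComplexPoints S, IsRationalClass (complexBetti.map (fiberι f s) (2 * p) W) ∧
        IsOfHodgeType n (fiberOver f s) (2 * p) p p (complexBetti.map (fiberι f s) (2 * p) W)) →
      (∃ s₀ : ComplexPoints S,
        complexBetti.map (fiberι f s₀) (2 * p) W ∈ algebraicClasses (fiberOver f s₀) p) →
      ∀ s : ComplexPoints S, complexBetti.map (fiberι f s) (2 * p) W ∈ algebraicClasses (fiberOver f s) p

/-- **`OneParameterAbelianSchemeVHCGerm` — germ form on one-parameter abelian schemes with quasi-projective total
space**: one algebraic fibre of a fibrewise rational `(p,p)` global class forces a non-empty Euclidean-OPEN set of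
algebraic fibres around it (the output shape of the semiregularity engines, Bloch 1972 Thm. 7.4 / Buchweitz–Flenner
2003 Thm. 5.1, over a one-dimensional base). Symbol for symbol the notation `AbelianSchemeVHCGermCurve[]` of
`Ring2BindersAbelianSchemeVHCCurveSection.lean`. OPEN as a blanket statement; a HYPOTHESIS wherever used.
[cite: Grothendieck1966, footnote 13] [cite: Bloch1972Semiregularity, Thm. 7.4] [cite: BuchweitzFlenner2003, Thm. 5.1] -/
@[conjecture] def OneParameterAbelianSchemeVHCGerm : Prop :=
  ∀ ⦃n : ℕ⦄ ⦃𝒳 S : SchemeOver ℂ⦄ (f : 𝒳 ⟶ S), IsSmoothProjectiveFamily f n → IsQuasiProjectiveOver 𝒳 →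
    IrreducibleSpace S.left → IsAffine S.left → AlgebraicGeometry.Smooth S.hom → topologicalKrullDim S.left = 1 →
    (∀ s : ComplexPoints S, ∃ A' : AbelianVariety ℂ, A'.dim = n ∧ Nonempty (A'.X ≅ fiberOver f s)) →
    (∃ e : S ⟶ 𝒳, e ≫ f = 𝟙 S) →
    ∀ (p : ℕ) (W : complexBetti 𝒳 (2 * p)),
      (∀ s : ComplexPoints S, IsRationalClass (complexBetti.map (fiberι f s) (2 * p) W) ∧
        IsOfHodgeType n (fiberOver f s) (2 * p) p p (complexBetti.map (fiberι f s) (2 * p) W)) →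
      ∀ s₀ : ComplexPoints S,
        complexBetti.map (fiberι f s₀) (2 * p) W ∈ algebraicClasses (fiberOver f s₀) p →
        ∃ U : Set (ComplexPoints S), IsOpen U ∧ s₀ ∈ U ∧
          ∀ s ∈ U, complexBetti.map (fiberι f s) (2 * p) W ∈ algebraicClasses (fiberOver f s) p

/-- **(U) `OneParameterAbelianSchemeVHCUncountable` — one algebraic fibre forces UNCOUNTABLY MANY.** For `f : 𝒳 ⟶ S`
a smooth projective family with quasi-projective total space and a section over a smooth irreducible affine CURVE,
all complex fibres abelian varieties, and `W ∈ H²ᵖ(𝒳(ℂ);ℂ)` fibrewise rational `(p,p)`: if `W|_{𝒳_{s₀}}` is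
algebraic then the algebraicity locus `{s ∈ S(ℂ) | W|_{𝒳_s} algebraic}` is NOT COUNTABLE. Weaker than the germ form
(a non-empty open set of `S(ℂ)` is uncountable) and still ⟺ row b02 modulo the print residual
(`abelianSchemeVHC_iff_uncountable_of_oneParameterAbelianSchemeQuasiProjective`); the threshold is sharp for the
closing method (`exists_subset_iUnion_of_countable`). NEW node of this file. OPEN; a HYPOTHESIS wherever used, never
asserted. [cite: Grothendieck1966, footnote 13] [cite: CharlesSchnell2014Notes, Conj. 11.3.1 and Prop. 11.3.11 (proof)] -/
@[conjecture] def OneParameterAbelianSchemeVHCUncountable : Prop :=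
  ∀ ⦃n : ℕ⦄ ⦃𝒳 S : SchemeOver ℂ⦄ (f : 𝒳 ⟶ S), IsSmoothProjectiveFamily f n → IsQuasiProjectiveOver 𝒳 →
    IrreducibleSpace S.left → IsAffine S.left → AlgebraicGeometry.Smooth S.hom → topologicalKrullDim S.left = 1 →
    (∀ s : ComplexPoints S, ∃ A' : AbelianVariety ℂ, A'.dim = n ∧ Nonempty (A'.X ≅ fiberOver f s)) →
    (∃ e : S ⟶ 𝒳, e ≫ f = 𝟙 S) →
    ∀ (p : ℕ) (W : complexBetti 𝒳 (2 * p)),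
      (∀ s : ComplexPoints S, IsRationalClass (complexBetti.map (fiberι f s) (2 * p) W) ∧
        IsOfHodgeType n (fiberOver f s) (2 * p) p p (complexBetti.map (fiberι f s) (2 * p) W)) →
      ∀ s₀ : ComplexPoints S,
        complexBetti.map (fiberι f s₀) (2 * p) W ∈ algebraicClasses (fiberOver f s₀) p →
        ¬ {s : ComplexPoints S |
            complexBetti.map (fiberι f s) (2 * p) W ∈ algebraicClasses (fiberOver f s) p}.Countable

/-- **`AbelianSchemeQuasiProjective` — the affine print residual**: the total space of a smooth proper family
`f : 𝒳 ⟶ S` with abelian-variety complex fibres AND A SECTION over a smooth irreducible affine `ℂ`-scheme is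
quasi-projective over `ℂ`. THEOREM IN PRINT, unformalised (no relative Picard functor / cube theorem over a base in the
tree): the section makes `f` an abelian scheme [cite: LaurentSchroer2023, Prop. 4.3] ([cite: MumfordGIT, Thm. 6.14]
for projective `f`), and an abelian scheme over a normal noetherian base is projective over it
[cite: GortzWedhorn2023, Thm. 27.291] (after [cite: Raynaud1970, Ch. XI]). Symbol for symbol the notation
`AbelianSectionQuasiProjective[]` of `Ring2BindersAbelianSchemeVHCSection.lean`. Typed as an obligation node (like
`Ring2.Hypotheses.MumfordTateCMAnchors`): a HYPOTHESIS wherever used, never asserted, never cited as a fact. -/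
@[conjecture] def AbelianSchemeQuasiProjective : Prop :=
  ∀ ⦃n : ℕ⦄ ⦃𝒳 S : SchemeOver ℂ⦄ (f : 𝒳 ⟶ S), IsSmoothProjectiveFamily f n → IrreducibleSpace S.left →
    IsAffine S.left → AlgebraicGeometry.Smooth S.hom →
    (∀ s : ComplexPoints S, ∃ A' : AbelianVariety ℂ, A'.dim = n ∧ Nonempty (A'.X ≅ fiberOver f s)) →
    (∃ e : S ⟶ 𝒳, e ≫ f = 𝟙 S) → IsQuasiProjectiveOver 𝒳

/-- **`OneParameterAbelianSchemeQuasiProjective` — the curve print residual**: the same over smooth irreducible affine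
CURVES (a one-parameter abelian scheme over a Dedekind base is projective over it). THEOREM IN PRINT, unformalised
[cite: GortzWedhorn2023, Thm. 27.291] [cite: LaurentSchroer2023, Prop. 4.3] [cite: Raynaud1970, Ch. XI]. Symbol for
symbol the notation `AbelianSectionCurveQuasiProjective[]` of `Ring2BindersAbelianSchemeVHCCurveSection.lean`; implied by
`AbelianSchemeQuasiProjective`. An obligation node: a HYPOTHESIS wherever used, never asserted, never cited as a fact. -/
@[conjecture] def OneParameterAbelianSchemeQuasiProjective : Prop :=
  ∀ ⦃n : ℕ⦄ ⦃𝒳 S : SchemeOver ℂ⦄ (f : 𝒳 ⟶ S), IsSmoothProjectiveFamily f n → IrreducibleSpace S.left →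
    IsAffine S.left → AlgebraicGeometry.Smooth S.hom → topologicalKrullDim S.left = 1 →
    (∀ s : ComplexPoints S, ∃ A' : AbelianVariety ℂ, A'.dim = n ∧ Nonempty (A'.X ≅ fiberOver f s)) →
    (∃ e : S ⟶ 𝒳, e ≫ f = 𝟙 S) → IsQuasiProjectiveOver 𝒳

/-! ## §2 Row b02 IS each of its with-section forms (by name, unconditional) -/

/-- **Row b02 ⟺ `AbelianSchemeVHCSection`** — the landed (S1′) `abelianSchemeVHC_iff_section` by name (étale-local
sections, EGA IV₄ 17.16.3; SGA 1 XII 2.4 / 3.1 (iii)). [cite: Grothendieck1967, EGA IV₄ Cor. 17.16.3 (ii)]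
[cite: CharlesSchnell2014Notes, Conj. 11.3.1] -/
theorem abelianSchemeVHC_iff_abelianSchemeVHCSection : AbelianSchemeVHC ↔ AbelianSchemeVHCSection :=
  abelianSchemeVHC_iff_section

/-- **Row b02 ⟺ `OneParameterAbelianSchemeVHC`** — the landed (C1′) `abelianSchemeVHC_iff_sectionCurve` by name
(étale-local sections, then the AnchorTransport curve reduction with Mumford's lemma proved).
[cite: MumfordAV1970, §6, Lemma] [cite: CharlesSchnell2014Notes, Conj. 11.3.1] -/
theorem abelianSchemeVHC_iff_oneParameterAbelianSchemeVHC : AbelianSchemeVHC ↔ OneParameterAbelianSchemeVHC :=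
  abelianSchemeVHC_iff_sectionCurve

/-- ON-PATH: the summit gives `AbelianSchemeVHCSection`. [folklore] -/
theorem abelianSchemeVHCSection_of_hodgeConjecture (h : _root_.HodgeConjecture) : AbelianSchemeVHCSection :=
  abelianSchemeVHC_iff_abelianSchemeVHCSection.mp (abelianSchemeVHC_of_hodgeConjecture h)

/-- ON-PATH: the summit gives `OneParameterAbelianSchemeVHC`. [folklore] -/
theorem oneParameterAbelianSchemeVHC_of_hodgeConjecture (h : _root_.HodgeConjecture) :
    OneParameterAbelianSchemeVHC :=
  abelianSchemeVHC_iff_oneParameterAbelianSchemeVHC.mp (abelianSchemeVHC_of_hodgeConjecture h)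

/-- **`HC_AV` ⟺ `OneParameterAbelianSchemeVHC`, modulo André 1996 Lemme 6.3.1 and Lemmes 6.3.2–6.3.3 only** — the
landed (C4) `hc_av_iff_abelianSchemeVHCSectionCurve_of_andre1996` by name. No `HC_CM`, no residual.
[cite: Andre1996Motifs, §6.3 Lemmes 6.3.1–6.3.3 and Remarque 2 (p. 33)] [cite: CharlesSchnell2014Notes, Cor. 11.3.6] -/
theorem hc_av_iff_oneParameterAbelianSchemeVHC_of_andre1996 (h₂₁ : andre1996_cmAnchoredPencil)
    (h₂₂ : andre1996_cmHodgeClasses_algebraicallyAnchoredPencils) :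
    Theses.PadicSemiregularLift.HodgeAbelianVarieties ↔ OneParameterAbelianSchemeVHC :=
  hc_av_iff_abelianSchemeVHCSectionCurve_of_andre1996 h₂₁ h₂₂

/-! ## §3 Germ form and uncountable form: the fact-free arrows out of row b02 -/

/-- Row b02 gives its germ form on one-parameter abelian schemes (the open set is the whole base) — the landed
`abelianSchemeVHCGermCurve_of_abelianSchemeVHC` by name. [folklore] -/
theorem oneParameterAbelianSchemeVHCGerm_of_abelianSchemeVHC (h : AbelianSchemeVHC) :
    OneParameterAbelianSchemeVHCGerm :=
  abelianSchemeVHCGermCurve_of_abelianSchemeVHC h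

/-- **A non-empty open set of complex points of a smooth irreducible curve is uncountable**: `C(ℂ)` is connected
(SGA 1 XII 2.4), so `C` is smooth of ONE relative dimension `m` (`exists_smoothOfRelativeDimension_of_connectedSpace_complexPoints`),
`m = dim C = 1 ≥ 1` (`topologicalKrullDim_eq_of_smoothOfRelativeDimension`), and non-empty opens of the `2m`-manifold
`C(ℂ)` are uncountable (`Theorems.not_countable_of_isOpen_complexPoints`). [cite: SerreGAGA1956, §2 n°5 Prop. 2 and n°6] -/
theorem not_countable_of_isOpen_of_curve {C : SchemeOver ℂ} [IrreducibleSpace C.left]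
    [AlgebraicGeometry.Smooth C.hom] (hdim : topologicalKrullDim C.left = 1) {U : Set (ComplexPoints C)}
    (hU : IsOpen U) (hne : U.Nonempty) : ¬ U.Countable := by
  haveI : LocallyOfFiniteType C.hom := inferInstance
  haveI : ConnectedSpace (ComplexPoints C) := connectedSpace_complexPoints_of_irreducibleSpace C
  obtain ⟨m, hm⟩ := exists_smoothOfRelativeDimension_of_connectedSpace_complexPoints C
  haveI := hm
  have hm1 : 1 ≤ m := by
    have h := topologicalKrullDim_eq_of_smoothOfRelativeDimension C.hom m
    rw [hdim] at h
    have : (1 : WithBot ℕ∞) ≤ m := h.le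
    exact_mod_cast this
  exact Theorems.not_countable_of_isOpen_complexPoints C hm1 hU hne

/-- **Germ form ⟹ (U)**: the open set of algebraic fibres around the anchor is uncountable
(`not_countable_of_isOpen_of_curve`), and it lies in the algebraicity locus. [cite: SerreGAGA1956, §2 n°5 Prop. 2 and n°6] -/
theorem oneParameterAbelianSchemeVHCUncountable_of_germ (h : OneParameterAbelianSchemeVHCGerm) :
    OneParameterAbelianSchemeVHCUncountable := by
  intro n 𝒳 S f hf h𝒳 hirr haff hsm hdim habel he p W hW s₀ hs₀ hc
  obtain ⟨U, hUo, hs₀U, hUalg⟩ := h f hf h𝒳 hirr haff hsm hdim habel he p W hW s₀ hs₀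
  haveI := hirr
  haveI := hsm
  exact not_countable_of_isOpen_of_curve hdim hUo ⟨s₀, hs₀U⟩ (hc.mono fun s hs => hUalg s hs)

/-- **Row b02 ⟹ (U)** (through the germ form). [folklore] -/
theorem oneParameterAbelianSchemeVHCUncountable_of_abelianSchemeVHC (h : AbelianSchemeVHC) :
    OneParameterAbelianSchemeVHCUncountable :=
  oneParameterAbelianSchemeVHCUncountable_of_germ (oneParameterAbelianSchemeVHCGerm_of_abelianSchemeVHC h)

/-- ON-PATH: the summit gives the germ form. [folklore] -/
theorem oneParameterAbelianSchemeVHCGerm_of_hodgeConjecture (h : _root_.HodgeConjecture) :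
    OneParameterAbelianSchemeVHCGerm :=
  oneParameterAbelianSchemeVHCGerm_of_abelianSchemeVHC (abelianSchemeVHC_of_hodgeConjecture h)

/-- ON-PATH: the summit gives (U). [folklore] -/
theorem oneParameterAbelianSchemeVHCUncountable_of_hodgeConjecture (h : _root_.HodgeConjecture) :
    OneParameterAbelianSchemeVHCUncountable :=
  oneParameterAbelianSchemeVHCUncountable_of_abelianSchemeVHC (abelianSchemeVHC_of_hodgeConjecture h)

/-! ## §4 (U) closes row b02, modulo the curve residual — and the threshold is sharp -/

/-- **On a smooth irreducible affine curve an UNCOUNTABLE set of complex points is thick**: it is not contained in any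
countable union `⋃ₖ Zₖ(ℂ)` with every `Zₖ ⊊ C` Zariski-closed and proper — each such `Zₖ` is finite
(`Theorems.finite_of_isClosed_ne_univ_of_topologicalKrullDim_le_one`) with finitely many complex points over it
(`Theorems.finite_setOf_pt_mem`), so the union is countable. [folklore] -/
theorem curve_not_subset_iUnion_of_not_countable {C : SchemeOver ℂ} [IsAffine C.left] [IrreducibleSpace C.left]
    [AlgebraicGeometry.Smooth C.hom] (hdim : topologicalKrullDim C.left = 1) (Λ : Set (ComplexPoints C))
    (hΛ : ¬ Λ.Countable) (Z : ℕ → Set C.left) (hZc : ∀ k, IsClosed (Z k)) (hZne : ∀ k, Z k ≠ Set.univ) :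
    ¬ Λ ⊆ ⋃ k, {t : ComplexPoints C | t.pt ∈ Z k} := by
  intro hsub
  haveI : IsLocallyNoetherian C.left := LocallyOfFiniteType.isLocallyNoetherian C.hom
  haveI : CompactSpace C.left := isCompact_univ_iff.mp (isAffineOpen_top C.left).isCompact
  haveI : IsNoetherian C.left := {}
  exact hΛ ((Set.countable_iUnion fun k => (Theorems.finite_setOf_pt_mem
    (Theorems.finite_of_isClosed_ne_univ_of_topologicalKrullDim_le_one hdim.le (hZc k) (hZne k))).countable).mono
      hsub)

/-- **SHARPNESS: every COUNTABLE set of complex points of a curve is covered by countably many proper Zariski-closed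
subsets** (the closed points under an enumeration; a point is a proper closed subset since `dim C = 1`). So the
closing lemma `Theorems.mem_algebraicClasses_of_thickSet` can never be fed a countable set of algebraic fibres —
(U) is exactly its threshold over one-dimensional bases. [folklore] -/
theorem exists_subset_iUnion_of_countable {C : SchemeOver ℂ} [IrreducibleSpace C.left]
    (hdim : topologicalKrullDim C.left = 1) (Λ : Set (ComplexPoints C)) (hΛ : Λ.Countable) :
    ∃ Z : ℕ → Set C.left, (∀ k, IsClosed (Z k)) ∧ (∀ k, Z k ≠ Set.univ) ∧
      Λ ⊆ ⋃ k, {t : ComplexPoints C | t.pt ∈ Z k} := by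
  -- a point is a proper subset of the one-dimensional `C`
  have hpt : ∀ x : C.left, ({x} : Set C.left) ≠ Set.univ := by
    intro x hx
    haveI : Subsingleton C.left :=
      ⟨fun a b => by rw [Set.eq_univ_iff_forall] at hx; rw [hx a, hx b]⟩
    have h0 := topologicalKrullDim_zero_of_discreteTopology C.left
    rw [hdim] at h0
    exact absurd h0 (by decide)
  rcases Λ.eq_empty_or_nonempty with hE | hne
  · exact ⟨fun _ => ∅, fun _ => isClosed_empty, fun _ => Set.empty_ne_univ, by simp [hE]⟩
  · obtain ⟨g, hg⟩ := hΛ.exists_eq_range hne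
    refine ⟨fun k => {(g k).pt}, fun k => AlgPoints.isClosed_singleton_pt (g k), fun k => hpt _, fun t ht => ?_⟩
    obtain ⟨k, rfl⟩ : t ∈ Set.range g := hg ▸ ht
    exact Set.mem_iUnion.2 ⟨k, rfl⟩

/-- **(U) ⟹ row b02, granted only the curve residual `OneParameterAbelianSchemeQuasiProjective`.** Reduce row b02 to
one-parameter abelian schemes (`abelianSchemeVHC_iff_oneParameterAbelianSchemeVHC`); there the total space is
quasi-projective by the residual and the affine base is quasi-projective (`IsQuasiProjectiveOver.of_isAffine`), the
algebraicity locus of `W` is uncountable by (U), hence thick (`curve_not_subset_iUnion_of_not_countable`), hence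
everything by the closing lemma `Theorems.mem_algebraicClasses_of_thickSet` fed with the tree's PROVED
`charlesSchnell_algebraicityLocus_iUnion_closed_holds` (relative Hilbert schemes). No fact binder.
[cite: CharlesSchnell2014Notes, Prop. 11.3.11 (proof)] [cite: VoisinHodgeII2003, §7.3.2, proof of Thm. 7.19]
[cite: GortzWedhorn2023, Thm. 27.291] -/
theorem abelianSchemeVHC_of_uncountable_of_oneParameterAbelianSchemeQuasiProjective
    (hqp : OneParameterAbelianSchemeQuasiProjective) (hU : OneParameterAbelianSchemeVHCUncountable) :
    AbelianSchemeVHC := by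
  refine abelianSchemeVHC_iff_oneParameterAbelianSchemeVHC.mpr ?_
  intro n 𝒳 S f hf hirr haff hsm hdim habel he p W hW h₀ s
  obtain ⟨s₀, hs₀⟩ := h₀
  have h𝒳 : IsQuasiProjectiveOver 𝒳 := hqp f hf hirr haff hsm hdim habel he
  haveI := hirr
  haveI := haff
  haveI := hsm
  haveI : LocallyOfFiniteType S.hom := inferInstance
  exact Theorems.mem_algebraicClasses_of_thickSet charlesSchnell_algebraicityLocus_iUnion_closed_holds f hf h𝒳
    (IsQuasiProjectiveOver.of_isAffine S) hsm W
    {t : ComplexPoints S | complexBetti.map (fiberι f t) (2 * p) W ∈ algebraicClasses (fiberOver f t) p}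
    (curve_not_subset_iUnion_of_not_countable hdim _ (hU f hf h𝒳 hirr haff hsm hdim habel he p W hW s₀ hs₀))
    (fun t ht => ht) s

/-- **EXACTNESS modulo the curve residual: row b02 `AbelianSchemeVHC` ⟺ (U)** — on one-parameter abelian schemes with
quasi-projective total space, a Hodge class algebraic on one fibre is algebraic on uncountably many.
[cite: CharlesSchnell2014Notes, Conj. 11.3.1 and Prop. 11.3.11 (proof)] [cite: GortzWedhorn2023, Thm. 27.291] -/
theorem abelianSchemeVHC_iff_uncountable_of_oneParameterAbelianSchemeQuasiProjective
    (hqp : OneParameterAbelianSchemeQuasiProjective) :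
    AbelianSchemeVHC ↔ OneParameterAbelianSchemeVHCUncountable :=
  ⟨oneParameterAbelianSchemeVHCUncountable_of_abelianSchemeVHC,
    abelianSchemeVHC_of_uncountable_of_oneParameterAbelianSchemeQuasiProjective hqp⟩

/-- **EXACTNESS modulo the curve residual: row b02 ⟺ its germ form on one-parameter abelian schemes** — the landed
(C2′) `abelianSchemeVHC_iff_germCurve_of_abelianSectionCurveQuasiProjective` by name.
[cite: CharlesSchnell2014Notes, Conj. 11.3.1 and Prop. 11.3.11 (proof)] [cite: GortzWedhorn2023, Thm. 27.291] -/
theorem abelianSchemeVHC_iff_germ_of_oneParameterAbelianSchemeQuasiProjective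
    (hqp : OneParameterAbelianSchemeQuasiProjective) : AbelianSchemeVHC ↔ OneParameterAbelianSchemeVHCGerm :=
  abelianSchemeVHC_iff_germCurve_of_abelianSectionCurveQuasiProjective hqp

/-- **`HC_AV` ⟺ (U)**, modulo André 1996 #21/#22 and the curve residual: deform IV's (E₂′)
`Deform.HC_AV_iff_abelianSchemeVHC_of_andre1996` composed with the exactness above. No `HC_CM`.
[cite: Andre1996Motifs, §6.3 Lemmes 6.3.1–6.3.3 and Remarque 2 (p. 33)] [cite: CharlesSchnell2014Notes, Prop. 11.3.11 (proof)] -/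
theorem hc_av_iff_oneParameterAbelianSchemeVHCUncountable_of_andre1996
    (h₂₁ : andre1996_cmAnchoredPencil) (h₂₂ : andre1996_cmHodgeClasses_algebraicallyAnchoredPencils)
    (hqp : OneParameterAbelianSchemeQuasiProjective) :
    Theses.PadicSemiregularLift.HodgeAbelianVarieties ↔ OneParameterAbelianSchemeVHCUncountable :=
  (Deform.HC_AV_iff_abelianSchemeVHC_of_andre1996 h₂₁ h₂₂).trans
    (abelianSchemeVHC_iff_uncountable_of_oneParameterAbelianSchemeQuasiProjective hqp)

/-! ## §5 The residual chain and part XXVII's printed-carrier node (by name) -/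

/-- The curve residual is implied by the affine one (forget the dimension clause) — the landed
`abelianSectionCurveQuasiProjective_of_abelianSectionQuasiProjective` by name. [folklore] -/
theorem oneParameterAbelianSchemeQuasiProjective_of_abelianSchemeQuasiProjective
    (h : AbelianSchemeQuasiProjective) : OneParameterAbelianSchemeQuasiProjective :=
  abelianSectionCurveQuasiProjective_of_abelianSectionQuasiProjective h

/-- **`VariationalHodgeQP ⟹ AbelianSchemeVHC` granted only the curve residual** — the landed (C3) by name
(seat b03's junction (J1) on the printed quasi-projective carriers). [cite: CharlesSchnell2014Notes, Conj. 11.3.1]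
[cite: GortzWedhorn2023, Thm. 27.291] -/
theorem abelianSchemeVHC_of_variationalHodgeQP_of_oneParameterAbelianSchemeQuasiProjective
    (hqp : OneParameterAbelianSchemeQuasiProjective) (hV : VariationalHodgeQP) : AbelianSchemeVHC :=
  abelianSchemeVHC_of_variationalHodgeQP_of_abelianSectionCurveQuasiProjective hqp hV

/-- (C3, flat-section form) Charles–Schnell's Conj. 11.3.1 on its printed carriers (`FlatSectionsAlgebraicQP`, part
XXVII) reaches row b02 granted only the curve residual — by name. [cite: CharlesSchnell2014Notes, Conj. 11.3.1 and Thm. 11.3.4] -/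
theorem abelianSchemeVHC_of_flatSectionsAlgebraicQP_of_oneParameterAbelianSchemeQuasiProjective
    (hqp : OneParameterAbelianSchemeQuasiProjective) (hF : FlatSectionsAlgebraicQP) : AbelianSchemeVHC :=
  abelianSchemeVHC_of_flatSectionsAlgebraicQP_of_abelianSectionCurveQuasiProjective hqp hF

/-! ## Audit

`#print axioms` of every theorem above: `propext`, `Classical.choice`, `Quot.sound` (checked at submission). No
`sorry`; six `@[conjecture] def` obligation nodes (four forms of row b02, two print residuals), none asserted, none a
Literature fact; the only named facts displayed as hypotheses are André 1996 #21/#22 in the two `hc_av_iff_…` rows.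
-/

end Summit.HodgeConjecture.HodgeConjecture.Ring2.Binders

end
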